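import Summits.Ventures.PercRepro.C025ProfileStagedDemCap

/-!
# THE ROW `(3,4)` — WHERE THE RIGID LOAD LIVES, AND THE CRUDE BOUNDS (night-3 g12)
`proofs/NIGHT3-G12-STAGED.md` §6. (i) The independent `4`-sets: no `Ls`-pair, at most `4` basis parts of at most `1`
(`rigid_le_of_card_four`). (ii) The direction `x` of an `Ls`-pair `(y, x)` of `S` is a coloop of `S` (`x ∉ cl(S ∖ {x, y}) = cl(S ∖ x)`,
`rkN_erase_le_three_of_mem_lsPairs`), and a demanding coloop-triple is a coloop by definition: a rank-`4` set WITHOUT coloops has no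
demander at all — its rigid load is `0` (`rigid_eq_zero_of_coloopFree`). (iii) The toolbox: `ρ(E∖B) ≤ f_B + |T_B|`, so the excess is at
most the number of inner points (`jB_le_card_inner`); `ρ(E) ≤ f_B + 3` for a rank-`3` set, so in rank `≥ 5` `|F_B| ≥ f_B ≥ 2`
(`two_le_card_outer`); hence every `Ls`-term `ovf B x / |T_B|` is at most `1/|F_B| ≤ 1/2` (`ls_term_le_half`) and
**`rigid_le_crude`**: `rigid S ≤ #dcol S + #lsPairs S / 2` in rank `≥ 5`. With `#dcol S ≤ #coloops S` and `#lsPairs S ≤ |S| · #{coloops of S}`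
this settles the rigid bound on the rank-`4` sets with ONE coloop and at most `6` points (`rigid_le_four_of_one_coloop_of_card_le_six`).
What is left of `RigidBound` (rank `≥ 5`, simple): the one-coloop sets with `≥ 7` points and the two-coloop sets `Q ∪ {c, x}`
(`Q` collinear) — where the bound is tight.
-/
open scoped Matroid
namespace PercRepro
open Set Finset ThmH
namespace Staged
variable {α : Type} [DecidableEq α] {M : Matroid α} [M.Finite]
/-- A rank-`4` set with `4` points has no `Ls`-pair. -/
theorem lsPairs_eq_empty_of_card_four {S : Finset α} (hc : S.card = 4) :
    lsPairs M S = ∅ := by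
  rw [Finset.eq_empty_iff_forall_notMem]
  intro yx hyx
  rw [mem_lsPairs] at hyx
  have h3 := hyx.2.2.1
  have hc2 : ((S.erase yx.1).erase yx.2).card = 2 := by
    rw [Finset.card_erase_of_mem, Finset.card_erase_of_mem hyx.1.1, hc]
    rw [Finset.mem_erase]; exact ⟨hyx.2.1.symm, hyx.1.2⟩
  have := rkN_le_card (M := M) ((S.erase yx.1).erase yx.2)
  omega

/-- The basis part is at most `1`. -/
theorem rb_le_one (B : Finset α) (x : α) : rb M B x ≤ 1 := by
  unfold rb
  split_ifs
  · exact le_rfl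
  · rw [div_le_one (by positivity)]; linarith

/-- **The rigid bound on the independent `4`-sets**: a rank-`4` set with `4` points has rigid load `≤ 4`. -/
theorem rigid_le_of_card_four {S : Finset α} (hc : S.card = 4) :
    rigid M S ≤ 4 := by
  rw [rigid_eq, lsPairs_eq_empty_of_card_four hc, Finset.sum_empty, add_zero]
  calc ∑ x ∈ dcol M S, rb M (S.erase x) x ≤ ∑ _x ∈ dcol M S, (1 : ℚ) :=
        Finset.sum_le_sum (fun x _ => rb_le_one _ _)
    _ = ((dcol M S).card : ℚ) := by rw [Finset.sum_const, nsmul_eq_mul, mul_one]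
    _ ≤ 4 := by
        have : (dcol M S).card ≤ S.card := Finset.card_le_card (Finset.filter_subset _ _)
        rw [hc] at this
        exact_mod_cast this

/-- `S ∖ x = (S ∖ {y, x}) ∪ {y}` for `y ≠ x` in `S`. -/
theorem erase_eq_insert_erase_erase {S : Finset α} {y x : α} (hy : y ∈ S) (hyx : y ≠ x) :
    S.erase x = insert y ((S.erase y).erase x) := by
  rw [Finset.erase_right_comm, Finset.insert_erase]
  rw [Finset.mem_erase]; exact ⟨hyx, hy⟩

/-- **The direction of an `Ls`-pair is a coloop**: `ρ(S ∖ x) ≤ 3` for `(y, x) ∈ lsPairs S`, `S ⊆ gr M`. -/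
theorem rkN_erase_le_three_of_mem_lsPairs {S : Finset α} (hS : S ⊆ gr M) {yx : α × α}
    (h : yx ∈ lsPairs M S) : rkN M (S.erase yx.2) ≤ 3 := by
  rw [mem_lsPairs] at h
  obtain ⟨⟨hy, _⟩, hne, h3, _, hycl, _⟩ := h
  set B := (S.erase yx.1).erase yx.2 with hB
  have hBg : B ⊆ gr M := ((Finset.erase_subset _ _).trans (Finset.erase_subset _ _)).trans hS
  have hsub : S.erase yx.2 ⊆ clF M B := by
    rw [erase_eq_insert_erase_erase hy hne, ← hB]
    exact Finset.insert_subset hycl (subset_clF_self hBg)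
  calc rkN M (S.erase yx.2) ≤ rkN M (clF M B) := rkN_mono hsub
    _ = 3 := by rw [rkN_clF, h3]

/-- A rank-`4` set without coloops has no `Ls`-pair. -/
theorem lsPairs_eq_empty_of_coloopFree {S : Finset α} (hS : S ⊆ gr M)
    (hfree : ∀ x ∈ S, 4 ≤ rkN M (S.erase x)) : lsPairs M S = ∅ := by
  rw [Finset.eq_empty_iff_forall_notMem]
  intro yx h
  have h1 := rkN_erase_le_three_of_mem_lsPairs hS h
  have h2 := hfree yx.2 (mem_lsPairs.mp h).1.2
  omega

/-- A rank-`4` set without coloops has no demanding coloop-triple. -/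
theorem dcol_eq_empty_of_coloopFree {S : Finset α} (hfree : ∀ x ∈ S, 4 ≤ rkN M (S.erase x)) :
    dcol M S = ∅ := by
  rw [Finset.eq_empty_iff_forall_notMem]
  intro x h
  rw [mem_dcol] at h
  have := hfree x h.1
  omega

/-- **A rank-`4` set without coloops carries no rigid load.** -/
theorem rigid_eq_zero_of_coloopFree {S : Finset α} (hS : S ⊆ gr M)
    (hfree : ∀ x ∈ S, 4 ≤ rkN M (S.erase x)) : rigid M S = 0 := by
  rw [rigid_eq, lsPairs_eq_empty_of_coloopFree hS hfree, dcol_eq_empty_of_coloopFree hfree]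
  simp

/-- The rigid bound on the coloop-free rank-`4` sets. -/
theorem rigid_le_four_of_coloopFree {S : Finset α} (hS : S ⊆ gr M)
    (hfree : ∀ x ∈ S, 4 ≤ rkN M (S.erase x)) : rigid M S ≤ 4 := by
  rw [rigid_eq_zero_of_coloopFree hS hfree]; norm_num

/-- The rigid load is at most the number of demanding coloop-triples plus the `Ls` overflow: a bound by the basis parts. -/
theorem rigid_le_card_dcol_add {S : Finset α} :
    rigid M S ≤ ((dcol M S).card : ℚ) + ∑ yx ∈ lsPairs M S,
      ovf M ((S.erase yx.1).erase yx.2) yx.2 / ((inner M ((S.erase yx.1).erase yx.2)).card : ℚ) := by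
  rw [rigid_eq]
  have h : ∑ x ∈ dcol M S, rb M (S.erase x) x ≤ ((dcol M S).card : ℚ) := by
    calc ∑ x ∈ dcol M S, rb M (S.erase x) x ≤ ∑ _x ∈ dcol M S, (1 : ℚ) :=
          Finset.sum_le_sum (fun x _ => rb_le_one _ _)
      _ = ((dcol M S).card : ℚ) := by rw [Finset.sum_const, nsmul_eq_mul, mul_one]
  linarith

/-- Subadditivity of `rkN`. -/
theorem rkN_union_le (X Y : Finset α) : rkN M (X ∪ Y) ≤ rkN M X + rkN M Y := by
  have h := M.eRk_union_le_eRk_add_eRk (X : Set α) (Y : Set α)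
  rw [← Finset.coe_union, ← coe_rkN, ← coe_rkN, ← coe_rkN] at h
  exact_mod_cast h

/-- `crk M B = rkN M (gr M ∖ B)`. -/
theorem crk_eq_rkN (B : Finset α) : crk M B = rkN M (gr M \ B) := rfl

/-- **The complement rank is at most `f_B` plus the number of inner points.** -/
theorem crk_le_fB_add_card_inner {B : Finset α} (hB : B ⊆ gr M) :
    crk M B ≤ fB M B + (inner M B).card := by
  rw [crk_eq_rkN, gr_sdiff_eq_union hB]
  calc rkN M ((gr M \ clF M B) ∪ (clF M B \ B)) ≤ rkN M (gr M \ clF M B) + rkN M (clF M B \ B) :=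
        rkN_union_le _ _
    _ ≤ fB M B + (inner M B).card := by
        unfold fB outer inner
        exact Nat.add_le_add_left (rkN_le_card _) _

/-- **The excess is at most the number of inner points**: `j_B ≤ |T_B|`. -/
theorem jB_le_card_inner {B : Finset α} (hB : B ⊆ gr M) : jB M B ≤ (inner M B).card := by
  unfold jB
  have := crk_le_fB_add_card_inner (M := M) hB
  omega

omit [DecidableEq α] in
/-- The rank of the ground set as `rkN`. -/
theorem rkN_gr_eq : rkN M (gr M) = M.eRank.toNat := by
  unfold rkN; rw [coe_gr, M.eRk_ground]

/-- **The rank of `M` is at most `f_B + ρ(B)`**: the outer points and the plane of `B` together span. -/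
theorem eRank_toNat_le_fB_add_rkN (B : Finset α) :
    M.eRank.toNat ≤ fB M B + rkN M B := by
  have hcover : gr M ⊆ (gr M \ clF M B) ∪ clF M B := by
    intro x hx
    rw [Finset.mem_union, Finset.mem_sdiff]
    by_cases h : x ∈ clF M B
    · exact Or.inr h
    · exact Or.inl ⟨hx, h⟩
  calc M.eRank.toNat = rkN M (gr M) := rkN_gr_eq.symm
    _ ≤ rkN M ((gr M \ clF M B) ∪ clF M B) := rkN_mono hcover
    _ ≤ rkN M (gr M \ clF M B) + rkN M (clF M B) := rkN_union_le _ _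
    _ = fB M B + rkN M B := by rw [rkN_clF]; rfl

/-- In rank `≥ 5` a rank-`3` set has `f_B ≥ 2`. -/
theorem two_le_fB {B : Finset α} (h3 : rkN M B = 3) (hR : (5 : ℕ∞) ≤ M.eRank) :
    2 ≤ fB M B := by
  have h1 := eRank_toNat_le_fB_add_rkN (M := M) B
  have hRtop : M.eRank ≠ ⊤ := M.eRank_ne_top_iff.2 inferInstance
  have h5 : 5 ≤ M.eRank.toNat := by
    have := ENat.toNat_le_toNat hR hRtop
    simpa using this
  rw [h3] at h1
  omega

/-- In rank `≥ 5` a rank-`3` set has at least two outer points. -/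
theorem two_le_card_outer {B : Finset α} (h3 : rkN M B = 3) (hR : (5 : ℕ∞) ≤ M.eRank) :
    2 ≤ (outer M B).card :=
  (two_le_fB h3 hR).trans (rkN_le_card _)

/-- **Every `Ls`-term is at most `1/|F_B|`**: `ovf B x / |T_B| ≤ 1 / |F_B|`. -/
theorem ls_term_le_inv_card_outer {B : Finset α} (hB : B ⊆ gr M) (x : α) :
    ovf M B x / ((inner M B).card : ℚ) ≤ 1 / ((outer M B).card : ℚ) := by
  rcases Finset.eq_empty_or_nonempty (inner M B) with hE | hne
  · rw [ovf_eq_zero_of_inner_empty hB hE, zero_div]; positivity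
  have hTpos : (0 : ℚ) < (inner M B).card := by exact_mod_cast Finset.card_pos.mpr hne
  have hovf : ovf M B x ≤ jsh M B := by unfold ovf; linarith [take_nonneg (M := M) B x]
  have hj : (jB M B : ℚ) ≤ ((inner M B).card : ℚ) := by exact_mod_cast jB_le_card_inner hB
  rcases Finset.eq_empty_or_nonempty (outer M B) with hF | hFne
  · have : jsh M B = 0 := by unfold jsh; rw [hF]; simp
    rw [hF, Finset.card_empty, Nat.cast_zero, div_zero]
    apply div_nonpos_of_nonpos_of_nonneg _ hTpos.le
    linarith [ovf_nonneg (M := M) B x]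
  have hFpos : (0 : ℚ) < (outer M B).card := by exact_mod_cast Finset.card_pos.mpr hFne
  rw [div_le_div_iff₀ hTpos hFpos]
  calc ovf M B x * ((outer M B).card : ℚ) ≤ jsh M B * ((outer M B).card : ℚ) := by gcongr
    _ = (jB M B : ℚ) := by unfold jsh; field_simp
    _ ≤ 1 * ((inner M B).card : ℚ) := by rw [one_mul]; exact hj

/-- In rank `≥ 5` every `Ls`-term is at most `1/2`. -/
theorem ls_term_le_half {B : Finset α} (hB : B ⊆ gr M) (h3 : rkN M B = 3) (hR : (5 : ℕ∞) ≤ M.eRank) (x : α) :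
    ovf M B x / ((inner M B).card : ℚ) ≤ 1 / 2 := by
  refine (ls_term_le_inv_card_outer hB x).trans ?_
  have h2 : (2 : ℚ) ≤ (outer M B).card := by exact_mod_cast two_le_card_outer h3 hR
  exact one_div_le_one_div_of_le (by norm_num) h2

/-- **The crude bound**: in rank `≥ 5`, `rigid S ≤ #dcol S + #lsPairs S / 2` for `S ⊆ gr M`. -/
theorem rigid_le_crude {S : Finset α} (hS : S ⊆ gr M) (hR : (5 : ℕ∞) ≤ M.eRank) :
    rigid M S ≤ ((dcol M S).card : ℚ) + ((lsPairs M S).card : ℚ) / 2 := by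
  have h0 := rigid_le_card_dcol_add (M := M) (S := S)
  have hls : ∑ yx ∈ lsPairs M S, ovf M ((S.erase yx.1).erase yx.2) yx.2 /
      ((inner M ((S.erase yx.1).erase yx.2)).card : ℚ) ≤ ((lsPairs M S).card : ℚ) / 2 := by
    calc ∑ yx ∈ lsPairs M S, ovf M ((S.erase yx.1).erase yx.2) yx.2 / ((inner M ((S.erase yx.1).erase yx.2)).card : ℚ)
        ≤ ∑ _yx ∈ lsPairs M S, (1 / 2 : ℚ) := by
          apply Finset.sum_le_sum
          intro yx hyx
          have h := mem_lsPairs.mp hyx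
          have hBg : (S.erase yx.1).erase yx.2 ⊆ gr M :=
            ((Finset.erase_subset _ _).trans (Finset.erase_subset _ _)).trans hS
          exact ls_term_le_half hBg h.2.2.1 hR _
      _ = ((lsPairs M S).card : ℚ) / 2 := by rw [Finset.sum_const, nsmul_eq_mul]; ring
  linarith

/-- A demanding coloop-triple is a coloop. -/
theorem dcol_subset_coloops (S : Finset α) : dcol M S ⊆ (S.filter (fun t => rkN M (S.erase t) ≤ 3)) := by
  intro x hx
  rw [mem_dcol] at hx
  rw [Finset.mem_filter]
  exact ⟨hx.1, by omega⟩

/-- An `Ls`-pair `(y, x)` has `y ∈ S` and `x` a coloop of `S`. -/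
theorem lsPairs_subset_product {S : Finset α} (hS : S ⊆ gr M) :
    lsPairs M S ⊆ S ×ˢ (S.filter (fun t => rkN M (S.erase t) ≤ 3)) := by
  intro yx hyx
  have h := rkN_erase_le_three_of_mem_lsPairs hS hyx
  rw [mem_lsPairs] at hyx
  rw [Finset.mem_product]
  refine ⟨hyx.1.1, ?_⟩
  rw [Finset.mem_filter]
  exact ⟨hyx.1.2, h⟩

/-- `#lsPairs S ≤ |S| · #{coloops of S}`. -/
theorem card_lsPairs_le {S : Finset α} (hS : S ⊆ gr M) :
    (lsPairs M S).card ≤ S.card * ((S.filter (fun t => rkN M (S.erase t) ≤ 3))).card := by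
  calc (lsPairs M S).card ≤ (S ×ˢ (S.filter (fun t => rkN M (S.erase t) ≤ 3))).card := Finset.card_le_card (lsPairs_subset_product hS)
    _ = S.card * ((S.filter (fun t => rkN M (S.erase t) ≤ 3))).card := Finset.card_product _ _

/-- **The rigid bound on the rank-`4` sets with one coloop and at most `6` points** (rank `≥ 5`). -/
theorem rigid_le_four_of_one_coloop_of_card_le_six {S : Finset α} (hS : S ⊆ gr M) (hR : (5 : ℕ∞) ≤ M.eRank)
    (hk : ((S.filter (fun t => rkN M (S.erase t) ≤ 3))).card = 1) (hc : S.card ≤ 6) : rigid M S ≤ 4 := by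
  have h1 := rigid_le_crude hS hR
  have h2 : (dcol M S).card ≤ 1 := hk ▸ Finset.card_le_card (dcol_subset_coloops S)
  have h3 : (lsPairs M S).card ≤ 6 := by
    have := card_lsPairs_le (M := M) hS
    rw [hk, mul_one] at this
    omega
  have h2' : ((dcol M S).card : ℚ) ≤ 1 := by exact_mod_cast h2
  have h3' : ((lsPairs M S).card : ℚ) ≤ 6 := by exact_mod_cast h3
  linarith

end Staged
end PercRepro
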